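import Summits.KontsevichZagierPeriods.KontsevichZagierPeriods.Theorems.KzOnePeriodsG2SPaths

/-!
# G2S derivations, part 3: exactness `R dx/(2y) = d(E·y)`, linearity, the packaged relation theorems

Sub-problem `KzOnePeriods` ([cite: HuberWustholz2022, Thm 13.3 (2) p.121]); helper lane of the
kz1p derivation modules (cell pub-kz1p, seat 2, gen 16); parts 1–2 are `KzOnePeriodsG2SPlane`,
`KzOnePeriodsG2SPaths`.  This is the module imported by the generated per-case files
(`numerics/kz1p/kz1p/lean_deriv_g2s.py`, kz1p cases G2-03, G2-06, G2-10, G2-16 on the curve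
`y² = (x² − 18)(x² − 24)(x² − 30)`), which only instantiate its theorems with rational data checked
by `ring` / `norm_num`.

Derivations (membership in the `ℚ̄`-span of (R1)–(R5) [cite: HuberWustholz2022, §13.1 (A)–(B)
p.120], then the period identity by soundness, `evalCombination_eq_zero_of_isElementaryRelation`):
for query coefficients `α_i ∈ ℚ̄`, forms `P_i` and `R = Σ α_i P_i` with an exactness datum
`R = 2E′f + E f′` (scalar hypothesis `Red`, i.e. `R dx/(2y) = d(E·y)` on `C`):
(R1) linearity `θ_R = Σ α_i θ_{P_i}` (`theta_eq_sum`, `span_query`), (R2) `θ_R − d(E y)` vanishes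
on the tangent lines of `C` (`vanishes_reduce`), (R3) exactness of `d(E y)` (`span_reduce`);
packaged as `span_relation_closed` / `relation_closed` (`Σ α_i ∫_γ P_i dx/2y = 0` along every
closed `C¹` path on `C`) and `span_relation_path` / `relation_path`
(`= E(x₁)y₁ − E(x₀)y₀` along every `C¹` path between algebraic points `(x₀, y₀)`, `(x₁, y₁)`).

NOT covered by parts 1–3: relations through the elliptic factors `E_k′` (pull-back along `φ_k`
and the identification of the loop classes `φ_k∗ c_jk^±`), third-kind symbols, and explicit
`CurvePath` models of kz1p's cycles `c_jk^±` — the theorems quantify over all (closed) `C¹` paths.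
[cite: HuberWustholz2022, §13.1 (A)–(B) p.120, Thm 13.3 (2) p.121]

No new axioms; no statements of the programme are cited.
-/

noncomputable section

open MvPolynomial Set Complex Filter Topology
open Literature.NumberTheory.Transcendental Literature.NumberTheory.Transcendental.CurvePeriods
open Summit.KontsevichZagierPeriods.KzOnePeriods.E1Derivation

namespace Summit.KontsevichZagierPeriods.KzOnePeriods.G2SDerivation

local notation3 "InSpanRel " c:arg => ∃ (k : ℕ) (ρ : Fin k → (PeriodSymbol →₀ ℂ))
  (a : Fin k → ℂ), (∀ l, IsElementaryRelation (ρ l)) ∧ (∀ l, IsAlgebraic ℚ (a l)) ∧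
    c = ∑ l, a l • ρ l

/-- The symbol `(Z, ω, γ)` as an element of the formal period space. -/
local notation3 (prettyPrint := false) "Sy[" Z ", " hZ ", " ω ", " h ", " γ "]" =>
  (Finsupp.single (⟨Z, hZ, ω, h, γ⟩ : PeriodSymbol) (1 : ℂ) : PeriodSymbol →₀ ℂ)

/-- The period `∫_γ ω` of the symbol `(Z, ω, γ)`. -/
local notation3 (prettyPrint := false) "Pe[" Z ", " hZ ", " ω ", " h ", " γ "]" =>
  PeriodSymbol.period (⟨Z, hZ, ω, h, γ⟩ : PeriodSymbol)

/-- The unit symbol `𝟙 = (𝔸¹, dt, [0,1])`. -/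
local notation3 "𝟙" => (Finsupp.single PeriodSymbol.unit (1 : ℂ) : PeriodSymbol →₀ ℂ)

/-- The even sextic `f = x⁶ + a x⁴ + b x² + c ∈ ℂ[x, y]`. -/
local notation3 (prettyPrint := false) "fS[" a ", " b ", " c "]" =>
  ((X 0 : MvPolynomial (Fin 2) ℂ) ^ 6 + C a * X 0 ^ 4 + C b * X 0 ^ 2 + C c)

/-- The affine plane model `C_{a,b,c} = {y² = f(x)} ⊂ 𝔸²` of the genus-2 curve (minus `∞±`). -/
local notation3 (prettyPrint := false) "Cpl[" a ", " b ", " c "]" =>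
  (⟨2, 1, ![(X 1 : MvPolynomial (Fin 2) ℂ) ^ 2 - fS[a, b, c]]⟩ : CurveData)

/-- The polynomial `Σ_k π_k x^k ∈ ℂ[x, y]` with coefficient vector `π`. -/
local notation3 (prettyPrint := false) "Pol[" π "]" =>
  (∑ k, C (π k) * (X 0 : MvPolynomial (Fin 2) ℂ) ^ (k : ℕ))

/-- The even polynomial `U = Σ_{k<3} μ_k x^{2k}` (Bézout cofactor of `f`). -/
local notation3 (prettyPrint := false) "Upol[" μ "]" =>
  (∑ k : Fin 3, C (μ k) * (X 0 : MvPolynomial (Fin 2) ℂ) ^ (2 * (k : ℕ)))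

/-- The odd polynomial `V = Σ_{k<3} ν_k x^{2k+1}` (Bézout cofactor of `f′`). -/
local notation3 (prettyPrint := false) "Vpol[" ν "]" =>
  (∑ k : Fin 3, C (ν k) * (X 0 : MvPolynomial (Fin 2) ℂ) ^ (2 * (k : ℕ) + 1))

/-- `θ[μ, ν, π] = (½ P U y) dx + (P V) dy`, the polynomial representative of `P(x) dx/(2y)`. -/
local notation3 (prettyPrint := false) "θ[" μ ", " ν ", " π "]" =>
  (![C (1 / 2 : ℂ) * Pol[π] * Upol[μ] * X 1, Pol[π] * Vpol[ν]] :
    Fin 2 → MvPolynomial (Fin 2) ℂ)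

/-- The Bézout identity `U f + V f′ = 1` for `U = Σ μ_k x^{2k}`, `V = Σ ν_k x^{2k+1}` (scalar form). -/
local notation3 (prettyPrint := false) "Bez[" a ", " b ", " c ", " μ ", " ν "]" =>
  (∀ x : ℂ, (∑ k : Fin 3, μ k * x ^ (2 * (k : ℕ))) * (x ^ 6 + a * x ^ 4 + b * x ^ 2 + c) +
    (∑ k : Fin 3, ν k * x ^ (2 * (k : ℕ) + 1)) * (6 * x ^ 5 + 4 * a * x ^ 3 + 2 * b * x) = 1)

/-- The reduction identity `R = 2 E′ f + E f′` (i.e. `R dx/2y = d(E·y)` on the curve), scalar form,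
for `R = Σ ρ_k x^k` and `E = Σ e_j x^j`. -/
local notation3 (prettyPrint := false) "Red[" a ", " b ", " c ", " ρ ", " e "]" =>
  (∀ x : ℂ, ∑ k, ρ k * x ^ (k : ℕ) =
    2 * (∑ j, e j * ((j : ℕ) : ℂ) * x ^ ((j : ℕ) - 1)) * (x ^ 6 + a * x ^ 4 + b * x ^ 2 + c) +
      (∑ j, e j * x ^ (j : ℕ)) * (6 * x ^ 5 + 4 * a * x ^ 3 + 2 * b * x))

variable {a b c : ℂ}

/-! ### (R2) + (R3): reduction of `R(x) dx/2y` by an exact form `d(E(x)·y)` -/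

/-- `(Pol[e]·y)(z) = (Σ_j e_j z₀^j) z₁`. -/
theorem eval_PolX {M : ℕ} (e : Fin M → ℂ) (z : Fin 2 → ℂ) :
    eval z (Pol[e] * X 1) = (∑ j, e j * z 0 ^ (j : ℕ)) * z 1 := by
  rw [map_mul, eval_X, eval_Pol]

/-- `∂_x (Pol[e]·y)(z) = (Σ_j j e_j z₀^{j−1}) z₁`. -/
theorem eval_pderiv_zero_PolX {M : ℕ} (e : Fin M → ℂ) (z : Fin 2 → ℂ) :
    eval z (pderiv 0 (Pol[e] * X 1)) = (∑ j, e j * ((j : ℕ) : ℂ) * z 0 ^ ((j : ℕ) - 1)) * z 1 := by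
  rw [pderiv_mul, pderiv_X_of_ne (show (1 : Fin 2) ≠ 0 by decide), mul_zero, add_zero, map_mul,
    eval_X, eval_pderiv_zero_Pol]

/-- `∂_y (Pol[e]·y)(z) = Σ_j e_j z₀^j`. -/
theorem eval_pderiv_one_PolX {M : ℕ} (e : Fin M → ℂ) (z : Fin 2 → ℂ) :
    eval z (pderiv 1 (Pol[e] * X 1)) = ∑ j, e j * z 0 ^ (j : ℕ) := by
  rw [pderiv_mul, pderiv_one_Pol, zero_mul, zero_add, pderiv_X_self, mul_one, eval_Pol]

/-- **The reduction vanishes on the curve.**  If `R = 2 E′ f + E f′` as polynomials in `x`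
(i.e. `R dx/2y = d(E y)` on `y² = f`), then `θ_R − d(E·y)` vanishes on every tangent line of
`C_{a,b,c}` — including at the branch points `y = 0`. -/
theorem vanishes_reduce {μ ν : Fin 3 → ℂ} (hbez : Bez[a, b, c, μ, ν]) {N : ℕ} (ρ : Fin N → ℂ)
    {M : ℕ} (e : Fin M → ℂ) (hD : Red[a, b, c, ρ, e]) :
    VanishesOn Cpl[a, b, c] (θ[μ, ν, ρ] - formD (Pol[e] * X 1)) := by
  intro z hz v hv
  rw [mem_points_iff] at hz
  rw [mem_tangentSpace_iff] at hv
  rw [Fin.sum_univ_two]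
  simp only [Pi.sub_apply, formD, Matrix.cons_val_zero, Matrix.cons_val_one,
    map_sub, map_mul, eval_C, eval_X, eval_Pol, eval_Upol, eval_Vpol, eval_pderiv_zero_PolX,
    eval_pderiv_one_PolX]
  have hB := hbez (z 0)
  have hR := hD (z 0)
  set R := ∑ k, ρ k * z 0 ^ (k : ℕ) with hRdef
  set U := ∑ k : Fin 3, μ k * z 0 ^ (2 * (k : ℕ)) with hUdef
  set V := ∑ k : Fin 3, ν k * z 0 ^ (2 * (k : ℕ) + 1) with hVdef
  set E := ∑ j, e j * z 0 ^ (j : ℕ) with hEdef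
  set E' := ∑ j, e j * ((j : ℕ) : ℂ) * z 0 ^ ((j : ℕ) - 1) with hE'def
  linear_combination (1 / 2 * U * z 1 * v 0 + V * v 1) * hR +
    (E' * V * z 1 - 1 / 2 * E * U * z 1) * hv + (-2 * E' * V * v 1 + E * U * v 1) * hz +
    (E' * z 1 * v 0 + E * v 1) * hB

/-- **(R2) + (R3).**  If `R dx/2y = d(E·y)` then `(C, θ_R, γ) − (E(x₁)y₁ − E(x₀)y₀)·𝟙 ∈ RelF`
for every path `γ` from `(x₀, y₀)` to `(x₁, y₁)`. -/
theorem span_reduce (ha : IsAlgebraic ℚ a) (hb : IsAlgebraic ℚ b) (hc : IsAlgebraic ℚ c)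
    {μ ν : Fin 3 → ℂ} (hμ : ∀ k, IsAlgebraic ℚ (μ k)) (hν : ∀ k, IsAlgebraic ℚ (ν k))
    (hbez : Bez[a, b, c, μ, ν]) {N : ℕ} {ρ : Fin N → ℂ} (hρ : ∀ k, IsAlgebraic ℚ (ρ k))
    {M : ℕ} {e : Fin M → ℂ} (he : ∀ j, IsAlgebraic ℚ (e j)) (hD : Red[a, b, c, ρ, e])
    (γ : CurvePath Cpl[a, b, c]) :
    InSpanRel (Sy[Cpl[a, b, c], smooth ha hb hc hbez, θ[μ, ν, ρ], hasAlgCoeffs_theta hμ hν hρ, γ] -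
      ((∑ j, e j * γ.toFun 1 0 ^ (j : ℕ)) * γ.toFun 1 1 -
        (∑ j, e j * γ.toFun 0 0 ^ (j : ℕ)) * γ.toFun 0 1) • 𝟙) := by
  have hZ := smooth ha hb hc hbez
  have hθ := hasAlgCoeffs_theta hμ hν hρ
  have hP : HasAlgCoeffs (Pol[e] * X 1) := (hasAlgCoeffs_Pol he).mul (hasAlgCoeffs_X 1)
  have hdP : ∀ i, HasAlgCoeffs (formD (Pol[e] * X 1) i) := hP.formD
  have hdiff : ∀ i, HasAlgCoeffs ((θ[μ, ν, ρ] - formD (Pol[e] * X 1) :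
      Fin 2 → MvPolynomial (Fin 2) ℂ) i) := fun i => (hθ i).sub (hdP i)
  have r₁ := IsElementaryRelation.add Cpl[a, b, c] hZ γ θ[μ, ν, ρ]
    (θ[μ, ν, ρ] - formD (Pol[e] * X 1)) (formD (Pol[e] * X 1)) hθ hdiff hdP
    (sub_add_cancel _ _).symm
  have r₂ := IsElementaryRelation.vanish Cpl[a, b, c] hZ γ (θ[μ, ν, ρ] - formD (Pol[e] * X 1))
    hdiff (vanishes_reduce hbez ρ e hD)
  have r₃ := IsElementaryRelation.exact Cpl[a, b, c] hZ γ (Pol[e] * X 1) hP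
    (formD (Pol[e] * X 1)) hdP rfl
  obtain ⟨k, R, w, hR, hw, hs⟩ :=
    span_add (span_add (span_of_rel r₁) (span_of_rel r₂)) (span_of_rel r₃)
  refine ⟨k, R, w, hR, hw, ?_⟩
  rw [eval_PolX, eval_PolX] at hs
  rw [← hs]
  abel

/-! ### (R1): linearity in the form -/

/-- Linearity of `Pol`: `Pol[ρ] = Σ_i α_i Pol[π_i]` when `ρ = Σ_i α_i π_i` coefficientwise. -/
theorem Pol_eq_sum {m N : ℕ} (α : Fin m → ℂ) (π : Fin m → Fin N → ℂ) (ρ : Fin N → ℂ)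
    (hlin : ∀ k, ρ k = ∑ i, α i * π i k) : Pol[ρ] = ∑ i, C (α i) * Pol[π i] := by
  simp only [hlin, map_sum, map_mul, Finset.sum_mul, Finset.mul_sum, mul_assoc]
  rw [Finset.sum_comm]

/-- `p (Σ_i g_i) q r = Σ_i p g_i q r` (distribution helper with a fixed bracketing). -/
theorem mul_sum_mul_mul {ι : Type*} [Fintype ι] (g : ι → MvPolynomial (Fin 2) ℂ)
    (p q r : MvPolynomial (Fin 2) ℂ) : p * (∑ i, g i) * q * r = ∑ i, p * g i * q * r := by
  rw [Finset.mul_sum, Finset.sum_mul, Finset.sum_mul]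

/-- Linearity of `θ`: `θ[μ, ν, ρ] = Σ_i α_i • θ[μ, ν, π_i]` when `ρ = Σ_i α_i π_i`. -/
theorem theta_eq_sum (μ ν : Fin 3 → ℂ) {m N : ℕ} (α : Fin m → ℂ) (π : Fin m → Fin N → ℂ)
    (ρ : Fin N → ℂ) (hlin : ∀ k, ρ k = ∑ i, α i * π i k) :
    θ[μ, ν, ρ] = ∑ i, α i • θ[μ, ν, π i] := by
  funext j
  rw [Finset.sum_apply]
  fin_cases j
  · simp only [Fin.zero_eta, Matrix.cons_val_zero, Pi.smul_apply, smul_eq_C_mul]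
    rw [Pol_eq_sum α π ρ hlin, mul_sum_mul_mul]
    exact Finset.sum_congr rfl fun i _ => by ring
  · simp only [Fin.mk_one, Matrix.cons_val_one, Matrix.cons_val_zero, Pi.smul_apply,
      smul_eq_C_mul]
    rw [Pol_eq_sum α π ρ hlin, Finset.sum_mul]
    exact Finset.sum_congr rfl fun i _ => by ring

/-- **(R1).**  If `R = Σ αᵢ Pᵢ` then `Σ αᵢ (C, θ_{Pᵢ}, γ) − (C, θ_R, γ) ∈ RelF`. -/
theorem span_query (ha : IsAlgebraic ℚ a) (hb : IsAlgebraic ℚ b) (hc : IsAlgebraic ℚ c)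
    {μ ν : Fin 3 → ℂ} (hμ : ∀ k, IsAlgebraic ℚ (μ k)) (hν : ∀ k, IsAlgebraic ℚ (ν k))
    (hbez : Bez[a, b, c, μ, ν]) {m N : ℕ} {α : Fin m → ℂ} (hα : ∀ i, IsAlgebraic ℚ (α i))
    {π : Fin m → Fin N → ℂ} (hπ : ∀ i k, IsAlgebraic ℚ (π i k)) {ρ : Fin N → ℂ}
    (hρ : ∀ k, IsAlgebraic ℚ (ρ k)) (hlin : ∀ k, ρ k = ∑ i, α i * π i k)
    (γ : CurvePath Cpl[a, b, c]) :
    InSpanRel (∑ i, α i • Sy[Cpl[a, b, c], smooth ha hb hc hbez, θ[μ, ν, π i],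
        hasAlgCoeffs_theta hμ hν (hπ i), γ] -
      Sy[Cpl[a, b, c], smooth ha hb hc hbez, θ[μ, ν, ρ], hasAlgCoeffs_theta hμ hν hρ, γ]) := by
  have hZ := smooth ha hb hc hbez
  have hS : ∀ k, HasAlgCoeffs ((∑ i ∈ Finset.univ, α i • θ[μ, ν, π i]) k) :=
    hasAlgCoeffs_sum_apply _ _ fun i k => (hasAlgCoeffs_theta hμ hν (hπ i) k).smul (hα i)
  have h := span_single_sum_smul Cpl[a, b, c] hZ γ Finset.univ (fun i => θ[μ, ν, π i])
    (fun i => hasAlgCoeffs_theta hμ hν (hπ i)) α hα hS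
  rw [PeriodSymbol.mk_eq_mk hZ hS (hasAlgCoeffs_theta hμ hν hρ) γ
    (theta_eq_sum μ ν α π ρ hlin).symm] at h
  obtain ⟨k, R, w, hR, hw, hs⟩ := span_smul (isAlgebraic_one.neg : IsAlgebraic ℚ (-1 : ℂ)) h
  exact ⟨k, R, w, hR, hw, by rw [← hs, neg_one_smul, neg_sub]⟩

/-! ### The packaged relation theorems -/

/-- **A G2S relation, formal version.**  Data: a Bézout pair `(U, V)` for `f`, forms
`P₁, …, P_m` (coefficient vectors `π i`), algebraic coefficients `αᵢ`, and a reduction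
`Σ αᵢ Pᵢ = 2E′f + Ef′` (i.e. `Σ αᵢ Pᵢ dx/2y = d(E y)`).  Then for every path `γ` on `C_{a,b,c}`,
`Σ αᵢ (C, θ_{Pᵢ}, γ) − (E(x₁)y₁ − E(x₀)y₀)·𝟙` lies in the span `RelF` of the elementary relations
(R1)–(R5). -/
theorem span_relation (ha : IsAlgebraic ℚ a) (hb : IsAlgebraic ℚ b) (hc : IsAlgebraic ℚ c)
    {μ ν : Fin 3 → ℂ} (hμ : ∀ k, IsAlgebraic ℚ (μ k)) (hν : ∀ k, IsAlgebraic ℚ (ν k))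
    (hbez : Bez[a, b, c, μ, ν]) {m N : ℕ} {α : Fin m → ℂ} (hα : ∀ i, IsAlgebraic ℚ (α i))
    {π : Fin m → Fin N → ℂ} (hπ : ∀ i k, IsAlgebraic ℚ (π i k)) {ρ : Fin N → ℂ}
    (hρ : ∀ k, IsAlgebraic ℚ (ρ k)) (hlin : ∀ k, ρ k = ∑ i, α i * π i k)
    {M : ℕ} {e : Fin M → ℂ} (he : ∀ j, IsAlgebraic ℚ (e j)) (hD : Red[a, b, c, ρ, e])
    (γ : CurvePath Cpl[a, b, c]) :
    InSpanRel (∑ i, α i • Sy[Cpl[a, b, c], smooth ha hb hc hbez, θ[μ, ν, π i],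
        hasAlgCoeffs_theta hμ hν (hπ i), γ] -
      ((∑ j, e j * γ.toFun 1 0 ^ (j : ℕ)) * γ.toFun 1 1 -
        (∑ j, e j * γ.toFun 0 0 ^ (j : ℕ)) * γ.toFun 0 1) • 𝟙) := by
  obtain ⟨k, R, w, hR, hw, hs⟩ := span_add (span_query ha hb hc hμ hν hbez hα hπ hρ hlin γ)
    (span_reduce ha hb hc hμ hν hbez hρ he hD γ)
  exact ⟨k, R, w, hR, hw, by rw [← hs, sub_add_sub_cancel]⟩

/-- **A G2S relation along a closed path** (a cycle `c_{jk}^±`, say): `Σ αᵢ (C, θ_{Pᵢ}, γ) ∈ RelF`. -/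
theorem span_relation_closed (ha : IsAlgebraic ℚ a) (hb : IsAlgebraic ℚ b) (hc : IsAlgebraic ℚ c)
    {μ ν : Fin 3 → ℂ} (hμ : ∀ k, IsAlgebraic ℚ (μ k)) (hν : ∀ k, IsAlgebraic ℚ (ν k))
    (hbez : Bez[a, b, c, μ, ν]) {m N : ℕ} {α : Fin m → ℂ} (hα : ∀ i, IsAlgebraic ℚ (α i))
    {π : Fin m → Fin N → ℂ} (hπ : ∀ i k, IsAlgebraic ℚ (π i k)) {ρ : Fin N → ℂ}
    (hρ : ∀ k, IsAlgebraic ℚ (ρ k)) (hlin : ∀ k, ρ k = ∑ i, α i * π i k)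
    {M : ℕ} {e : Fin M → ℂ} (he : ∀ j, IsAlgebraic ℚ (e j)) (hD : Red[a, b, c, ρ, e])
    {γ : CurvePath Cpl[a, b, c]} (hγ : γ.toFun 1 = γ.toFun 0) :
    InSpanRel (∑ i, α i • Sy[Cpl[a, b, c], smooth ha hb hc hbez, θ[μ, ν, π i],
        hasAlgCoeffs_theta hμ hν (hπ i), γ]) := by
  have h := span_relation ha hb hc hμ hν hbez hα hπ hρ hlin he hD γ
  rwa [hγ, sub_self, zero_smul, sub_zero] at h

/-- **A G2S relation along a path with given endpoints**:
`Σ αᵢ (C, θ_{Pᵢ}, γ) − K·𝟙 ∈ RelF` with `K = E(x₁)y₁ − E(x₀)y₀`. -/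
theorem span_relation_path (ha : IsAlgebraic ℚ a) (hb : IsAlgebraic ℚ b) (hc : IsAlgebraic ℚ c)
    {μ ν : Fin 3 → ℂ} (hμ : ∀ k, IsAlgebraic ℚ (μ k)) (hν : ∀ k, IsAlgebraic ℚ (ν k))
    (hbez : Bez[a, b, c, μ, ν]) {m N : ℕ} {α : Fin m → ℂ} (hα : ∀ i, IsAlgebraic ℚ (α i))
    {π : Fin m → Fin N → ℂ} (hπ : ∀ i k, IsAlgebraic ℚ (π i k)) {ρ : Fin N → ℂ}
    (hρ : ∀ k, IsAlgebraic ℚ (ρ k)) (hlin : ∀ k, ρ k = ∑ i, α i * π i k)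
    {M : ℕ} {e : Fin M → ℂ} (he : ∀ j, IsAlgebraic ℚ (e j)) (hD : Red[a, b, c, ρ, e])
    {γ : CurvePath Cpl[a, b, c]} {x₀ y₀ x₁ y₁ K : ℂ} (h0 : γ.toFun 0 = ![x₀, y₀])
    (h1 : γ.toFun 1 = ![x₁, y₁])
    (hK : (∑ j, e j * x₁ ^ (j : ℕ)) * y₁ - (∑ j, e j * x₀ ^ (j : ℕ)) * y₀ = K) :
    InSpanRel (∑ i, α i • Sy[Cpl[a, b, c], smooth ha hb hc hbez, θ[μ, ν, π i],
        hasAlgCoeffs_theta hμ hν (hπ i), γ] - K • 𝟙) := by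
  have h := span_relation ha hb hc hμ hν hbez hα hπ hρ hlin he hD γ
  rw [h0, h1] at h
  simp only [Matrix.cons_val_zero, Matrix.cons_val_one] at h
  rwa [hK] at h

/-- Evaluation of `Σ_i α_i • [S_i]` is `Σ_i α_i ∫ S_i`. -/
theorem evalCombination_sum_smul_Sy {m : ℕ} (α : Fin m → ℂ) (S : Fin m → PeriodSymbol) :
    evalCombination (∑ i, α i • (Finsupp.single (S i) (1 : ℂ) : PeriodSymbol →₀ ℂ)) =
      ∑ i, α i * (S i).period := by
  rw [evalCombination_finsetSum]
  refine Finset.sum_congr rfl fun i _ => ?_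
  rw [evalCombination_smul, evalCombination_single, one_mul]

/-- Evaluation of `x − K • 𝟙` is `evalCombination x − K` (`∫_{[0,1]} dt = 1`). -/
theorem evalCombination_sub_smul_unit (x : PeriodSymbol →₀ ℂ) (K : ℂ) :
    evalCombination (x - K • 𝟙) = evalCombination x - K := by
  rw [sub_eq_add_neg, ← neg_smul, evalCombination_add, evalCombination_smul,
    evalCombination_single, period_unit]
  ring

/-- **Period identity along a closed path**: `Σ αᵢ ∫_γ θ_{Pᵢ} = 0`. -/
theorem relation_closed (ha : IsAlgebraic ℚ a) (hb : IsAlgebraic ℚ b) (hc : IsAlgebraic ℚ c)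
    {μ ν : Fin 3 → ℂ} (hμ : ∀ k, IsAlgebraic ℚ (μ k)) (hν : ∀ k, IsAlgebraic ℚ (ν k))
    (hbez : Bez[a, b, c, μ, ν]) {m N : ℕ} {α : Fin m → ℂ} (hα : ∀ i, IsAlgebraic ℚ (α i))
    {π : Fin m → Fin N → ℂ} (hπ : ∀ i k, IsAlgebraic ℚ (π i k)) {ρ : Fin N → ℂ}
    (hρ : ∀ k, IsAlgebraic ℚ (ρ k)) (hlin : ∀ k, ρ k = ∑ i, α i * π i k)
    {M : ℕ} {e : Fin M → ℂ} (he : ∀ j, IsAlgebraic ℚ (e j)) (hD : Red[a, b, c, ρ, e])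
    {γ : CurvePath Cpl[a, b, c]} (hγ : γ.toFun 1 = γ.toFun 0) :
    ∑ i, α i * Pe[Cpl[a, b, c], smooth ha hb hc hbez, θ[μ, ν, π i],
      hasAlgCoeffs_theta hμ hν (hπ i), γ] = 0 := by
  obtain ⟨k, R, w, hR, hw, hs⟩ :=
    span_relation_closed ha hb hc hμ hν hbez hα hπ hρ hlin he hD hγ
  have h0 := evalCombination_eq_zero_of_isElementaryRelation R w hR
  rwa [← hs, evalCombination_sum_smul_Sy] at h0

/-- **Period identity along a path**: `Σ αᵢ ∫_γ θ_{Pᵢ} − K = 0`, `K = E(x₁)y₁ − E(x₀)y₀`. -/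
theorem relation_path (ha : IsAlgebraic ℚ a) (hb : IsAlgebraic ℚ b) (hc : IsAlgebraic ℚ c)
    {μ ν : Fin 3 → ℂ} (hμ : ∀ k, IsAlgebraic ℚ (μ k)) (hν : ∀ k, IsAlgebraic ℚ (ν k))
    (hbez : Bez[a, b, c, μ, ν]) {m N : ℕ} {α : Fin m → ℂ} (hα : ∀ i, IsAlgebraic ℚ (α i))
    {π : Fin m → Fin N → ℂ} (hπ : ∀ i k, IsAlgebraic ℚ (π i k)) {ρ : Fin N → ℂ}
    (hρ : ∀ k, IsAlgebraic ℚ (ρ k)) (hlin : ∀ k, ρ k = ∑ i, α i * π i k)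
    {M : ℕ} {e : Fin M → ℂ} (he : ∀ j, IsAlgebraic ℚ (e j)) (hD : Red[a, b, c, ρ, e])
    {γ : CurvePath Cpl[a, b, c]} {x₀ y₀ x₁ y₁ K : ℂ} (h0 : γ.toFun 0 = ![x₀, y₀])
    (h1 : γ.toFun 1 = ![x₁, y₁])
    (hK : (∑ j, e j * x₁ ^ (j : ℕ)) * y₁ - (∑ j, e j * x₀ ^ (j : ℕ)) * y₀ = K) :
    ∑ i, α i * Pe[Cpl[a, b, c], smooth ha hb hc hbez, θ[μ, ν, π i],
      hasAlgCoeffs_theta hμ hν (hπ i), γ] - K = 0 := by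
  obtain ⟨k, R, w, hR, hw, hs⟩ :=
    span_relation_path ha hb hc hμ hν hbez hα hπ hρ hlin he hD h0 h1 hK
  have h := evalCombination_eq_zero_of_isElementaryRelation R w hR
  rwa [← hs, evalCombination_sub_smul_unit, evalCombination_sum_smul_Sy] at h

end Summit.KontsevichZagierPeriods.KzOnePeriods.G2SDerivation

end
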